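import Literature.MathematicalPhysics.QuantumFieldTheory.Balaban1983to89.B6AgreeLapV1Chart
import Literature.MathematicalPhysics.QuantumFieldTheory.Balaban1983to89.B6Partition118KLevelTorusBinders

/-!
# `Balaban1983to89.B6Prop26KLevelSkeletonV1` — T. Bałaban, *Propagators and renormalization transformations for lattice gauge theories. II*, Commun.
# Math. Phys. **96** (1984) 223–250 [Balaban1984PropagatorsII], Proposition 2.6 p. 247, entry (2.136)₁ `|G(x,x′)| ≤ C(L^jη)²e^{−δ₃d(y,y′)}` FOR THE
# GENUINE k-LEVEL `G = Δ_a⁻¹` OF (2.19)/(2.22) ON THE V1 TORUS — THE ASSEMBLY SKELETON: the gluing (2.91)/(2.133)–(2.135) with EVERYTHING GLOBAL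
# DISCHARGED (p38's periodic partition `h^T_□`/`ζ^T_□`/reach sets `Q^T_□` of (2.36) on `T_η`, the splitting `Δ_a = M − ∂P∂*`, `GΔ_a = 1`, the ring identity
# (2.91), Lemma 2.1 on the torus, the random-walk gluing with print's weight `P(y) = (L^{j(y)}η)²`) and the PER-CUBE MEMBER DATA displayed in their final
# shapes (item (iv) of the B6 fold owner's programme, B6-CLOSURE.md §5 item 13; the members themselves — transplanted two-scale `G_□` in each cube's
# chart, conjugated back — are supplied by (iii) + `B6TranslateTorusV1`, the (2.134) family bound by p38's `h2134_kFam_torus`)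

statement-level skeleton of published theorems with citation tags; proofs where landed; nothing here is a claim about the Yang–Mills mass gap

PDF held: `paper:balaban1984-cmp96-propagators-rt-ii` (journal page = PDF page + 222); p. 229 [PDF 7] ((2.36)), p. 234 [PDF 12] (Lemma 2.1), p. 239 [PDF 17]
((2.91)–(2.93) *"G₀ = Σ_{□∈𝒟} h_□G_□h_□ … Δ_aG₀ = I − R"*), p. 247 [PDF 25] ((2.133)–(2.136): *"Reasoning in the same way as in the proof of Proposition 2.2
we obtain Proposition 2.6 … |G(x, x′)|, |(∇G)(x, x′)|, … ≤ C(L^jη)²e^{−δ₃d(y,y′)} … (2.136)"*) re-read this generation.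

CITATION HEADER (lean-in-tree rule) — WHAT IS REPRODUCED.  Phase-2 file of the `lit-balaban` typed skeleton (HOME `run/shared/lean/pub/lit-balaban/`), unit
`lit-balaban-r03` (B6 fold owner; r03 gen 20, literature-prover-lit-balaban-r03-g20-0), referee ref-4.  SKELETON rows **B6.Prop2.6** × **B6.Eq2.91** ×
**B6.Eq2.133** × **B6.Eq2.134** × B6.Eq2.36 × B6.Lem2.1 (cells; decls of record untouched).  IMPORTS BY NAME, restating nothing: `B6Prop26ChainGeneric`
(pv09/r03: **`prop26_2136_of_2133_2134With`** — the gluing with a weight `P(y)`), `B6Eq291Generator` (p02: `kFam`, `gZero`, `rOp`, **`eq291`**),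
`B6Geom246MultiLevelTorus` (p21: `geomT`, **`lemma21_torus`**, `triangle_refl_nonneg_T`), `B6Ineq261LevelGap` (p29: `K261`), `B6GlobalChartV1` (r03 g18:
`PV`, `toBox`, `domT`, `blkV1`), `B6AgreeLapV1Chart` (r03 g19: **`deltaAE_split`**, `onFun_comp`, `onFun_id`), `B6SectAOperatorsV1`/`B6SectAVectorModelV1`
(p21 g5: `dE … QsE`, `RE`, `deltaAE`, `GE`, **`GE_comp_deltaAE`**), `B6Partition118KLevelTorus`/`…Central`/`…Binders` (p38 g26: **`hT`**, **`sum_hT_sq`**,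
`abs_hT_le_one`, **`QT`**, **`zetaT`**, **`zetaT_mul_hT`**, **`blkOf_mem_QT_of_hT_ne_zero`**), `B6Cover236MultiLevelBlocks` (p21: `cubes`), `B6RandomWalk`
(`HasMajorant`, `delta3`), `B6Prop26Gluing` (`mulOp`, `LocalMajorant`, `OutLoc`, `abs_le_one_of_sum_sq`), `B6Ineq2133TwoScaleV1` (`onFun`).

## WHAT THIS FILE CERTIFIES (kernel-checked, 0 sorry, standard axioms; NO `def … : Prop`, no new named fact; definitions WITH BODIES: `hB`, `zB` (p38's
`h^T_□`, `ζ^T_□` read on the fine bonds through the identity chart), `ST` (the reach set `Q^T_□` as a set of sites), `pref` (print's prefactor `(L^{j(y)}η)²`))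

* §1 the partition data of (2.91) on the V1 global torus, ALL DISCHARGED from p38's torus files: **`sum_hB_sq`** (`Σ_□ h_□² = 1`), `abs_hB_le_one`,
  **`blkV1_mem_QT_of_hB_ne_zero`** (`supp h_□` blockwise in `Q^T_□`), **`mulOp_zB_mul_hB`**/**`mulOp_hB_mul_zB`** (`ζ_□h_□ = h_□ = h_□ζ_□`), `sum_mulOp_hB_sq`.
* §2 `onFun_GE_mul_deltaAE` (`GΔ_a = 1` on bond functions) and **`prop26_2136_kLevel_skeleton`** — PROPOSITION 2.6 (2.136)₁ FOR THE GENUINE k-LEVEL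
  `G = GE (domT hN D hk)` ON `geomT D`: for every rate `δ > 0` and (2.133)-constant `A ≥ 0`, every V1 global torus with p21's family `D` (`hN`, `hk`, `M_h ≥ 2`,
  `R ≥ 2L`, `P′_μ ≥ 5`), Lemma-2.1 budget (`α`, `N₀`, the (2.59)-shape threshold of `lemma21_torus`), fine factor `c′ ≠ 0`, weights `w > 0`, overlap bound
  `Nov` of the `Q^T_□`, and per-cube members `G_□, M_□, P_□` with (h2133) the local majorant `A·(L^{j(y)}/c′)²·e^{−(δ′/2)d_T}` on `Q^T_□`, (hagree)
  `M·h_□ = M_□·h_□` for the LOCAL PART `M` of `Δ_a`, (hinvl) `(M_□ − P_□)·G_□·h_□ = h_□`, (h2134)+(hKout) for the genuine (2.91) family `kFam (∂(1−R)∂*) h ζ M P`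
  with `θ₀`, and `Nov²θ₀c₁ < 1`:  `HasMajorant (g := geomT D) (blkV1 hN D) (onFun (GE (domT hN D hk) hc′ hw)) ((Nov·A)·c₁·(1 − Nov²θ₀c₁)⁻¹·(L^{j(y)}/c′)²·e^{−δ₃d_T})`,
  `c₁ = K261 N₀ (d+1) L 1 (αδ′/2)`, `δ₃ = delta3 α δ′`, `δ′ = 2δ/(d+1)`.

## HONEST SCOPE / DIVERGENCES

(1) A SKELETON: the member operators are hypotheses here.  What discharges them, cube by cube, in the programme: (h2133) `B6FullWindowReachV1.reach2133_G_V1_full`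
in the cube's chart + `B6TranslateTorusV1.localMajorant_conj_chart` (scaled by `(L^{j₀}/c′)²`, dominated by `pref` since the window is two-level);
(hagree) `B6MemberOfCubeV1.hagree_tOf` in the chart + `B6TranslateTorusV1.onFun_localPart_eq_conj`/`mulOp_eq_conj`; (hinvl) `B6FullWindowReachV1.hinvl_GlV1_scaled`
conjugated; the window data ((iii) `B6CubeWindowV1`, to come); (h2134)/(hKout)/`θ₀ = O(M⁻¹)` p38's `B6Ineq2134KFamKLevelTorus.h2134_kFam_torus` with ITS
displayed per-cube inputs (commutator decomposition of `[h_□, M_□]`, (2.88) for `∂P∂*` = p22's `B6Dg288ChartV1.hasMajorant_Dg_V1`, the member's `∂P_□∂*`,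
the change-of-domain line 3); (Nov) the finite overlap of the `Q^T_□` (p21 g17 `B6Cover236MultiLevelTorusBlocks`, announced).  (2) `L ≥ 2`, `M_h ≥ 2`,
`R ≥ 2L`, `P′_μ ≥ 5` are p38's partition thresholds; `k ≤ m + K`; levels `1 … k` (no `Λ₀`); `m² = 0`; lattice factor `c′` free.  (3) Entries (2.136)₂₋₄ and
(2.137)–(2.140) are not touched.  Non-vacuity of the hypothesis set on the geometry side: p22's `B6V1TorusWitness.v1Torus_nonvacuous`.
Value = typed skeleton (the assembled implication for the genuine operator, with the remaining inputs literal); NOT summit progress.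
-/

noncomputable section

open scoped BigOperators
open Finset

namespace Literature.MathematicalPhysics.QuantumFieldTheory.Balaban1983to89.B6Prop26KLevelSkeletonV1

open B4Reflection242 (boxDom)
open B6MultiLevelBoxOperator (N0)
open B6MultiLevelTorusOperator (TDomains)
open B6Cover236MultiLevelBlocks (cubes)
open B6Geom246MultiLevelBox (bset blkOf)
open B6Geom246MultiLevelTorus (geomT lemma21_torus triangle_refl_nonneg_T)
open B6RandomWalk (HasMajorant delta3)
open B6Prop26Gluing (mulOp mulOp_apply LocalMajorant OutLoc abs_le_one_of_sum_sq)
open B6Ineq261LevelGap (K261 K261_nonneg)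
open B6Prop26ChainGeneric (prop26_2136_of_2133_2134With)
open B6Eq291Generator (kFam gZero rOp eq291)
open B6Ineq2133TwoScaleV1 (onFun)
open B6GlobalChartV1 (PV toBox domT blkV1)
open B6AgreeLapV1Chart (deltaAE_split onFun_comp onFun_id)
open B6SectAOperatorsV1 (dE dsE dcE dcsE QE aE QsE RE BondIdx)
open B6SectAVectorModelV1 (deltaAE GE GE_comp_deltaAE)
open B6Partition118KLevelTorus (hT sum_hT_sq abs_hT_le_one)
open B6Partition118KLevelTorusCentral (QT zetaT zetaT_mul_hT blkOf_mem_QT_of_hT_ne_zero one_le_of_four_le)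

variable {d ℓ : ℕ} {hd : 1 ≤ d + 1} {hL : Odd (ℓ + 1) ∧ 1 < ℓ + 1} {m K : ℕ} {Mh k R : ℕ} {P' : Fin (d + 1) → ℕ}

/-! ## §1  The partition data of (2.91) on the V1 global torus: p38's periodic `h^T_□`, `ζ^T_□`, reach sets `Q^T_□`, read on the fine bonds -/

section Data

variable (hN : ∀ μ, N0 ℓ Mh k P' μ = (PV d ℓ m K hd hL).sitesPerDir 0) (D : TDomains d ℓ Mh k P' R)

/-- **`h_□` ON THE FINE BONDS OF THE V1 TORUS**: `h_□(b) := h^T_□(b₋)` (p38's periodic partition (2.36) read at the initial point of the bond, through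
the identity chart). [cite: Balaban1984PropagatorsII, (2.36) p.229, (2.91) p.239] -/
def hB (c : ↥(cubes D.toDomains)) (b : PBond (PV d ℓ m K hd hL) 0) : ℝ := hT D c (toBox hN b.src)

/-- **`ζ_□` ON THE FINE BONDS**: the indicator-type cut-off of `□̃` (p38's `zetaT`) read at `b₋`. [cite: Balaban1984PropagatorsII, (2.91)–(2.92) p.239] -/
def zB (hMh1 : 1 ≤ Mh) (hP4 : ∀ μ, 4 ≤ P' μ) (c : ↥(cubes D.toDomains)) (b : PBond (PV d ℓ m K hd hL) 0) : ℝ :=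
  zetaT D hMh1 hP4 c (toBox hN b.src)

/-- unfolding `hB`. [cite: Balaban1984PropagatorsII, (2.36) p.229, dictionary] -/
@[simp] theorem hB_apply (c : ↥(cubes D.toDomains)) (b : PBond (PV d ℓ m K hd hL) 0) : hB hN D c b = hT D c (toBox hN b.src) := rfl

/-- unfolding `zB`. [cite: Balaban1984PropagatorsII, (2.91) p.239, dictionary] -/
@[simp] theorem zB_apply (hMh1 : 1 ≤ Mh) (hP4 : ∀ μ, 4 ≤ P' μ) (c : ↥(cubes D.toDomains)) (b : PBond (PV d ℓ m K hd hL) 0) :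
    zB hN D hMh1 hP4 c b = zetaT D hMh1 hP4 c (toBox hN b.src) := rfl

/-- **(2.36) ON THE FINE BONDS**: `Σ_□ h_□(b)² = 1`. [cite: Balaban1984PropagatorsII, (2.36) p.229] -/
theorem sum_hB_sq (hMh1 : 1 ≤ Mh) (hP : ∀ μ, 1 ≤ P' μ) (b : PBond (PV d ℓ m K hd hL) 0) :
    ∑ c ∈ Finset.univ, hB hN D c b ^ 2 = 1 := sum_hT_sq D hMh1 hP _

/-- `|h_□| ≤ 1`. [cite: Balaban1984PropagatorsII, (2.36) p.229] -/
theorem abs_hB_le_one (hMh1 : 1 ≤ Mh) (hP : ∀ μ, 1 ≤ P' μ) (c : ↥(cubes D.toDomains)) (b : PBond (PV d ℓ m K hd hL) 0) :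
    |hB hN D c b| ≤ 1 := abs_hT_le_one D hMh1 hP c _

/-- **THE REACH SET `Q^T_□` AS A SET OF SITES OF `geomT D`** (p38's `QT`: the blocks within `5S_j/4` of the cube's centre, through the block map).
[cite: Balaban1984PropagatorsII, (2.36) p.229 («□̃»), dictionary] -/
def ST (hMh1 : 1 ≤ Mh) (hP4 : ∀ μ, 4 ≤ P' μ) (c : ↥(cubes D.toDomains)) : Set (geomT D).Site := {a | a ∈ QT D hMh1 hP4 c}

/-- membership in `ST`. [cite: Balaban1984PropagatorsII, (2.36) p.229, dictionary] -/
@[simp] theorem mem_ST (hMh1 : 1 ≤ Mh) (hP4 : ∀ μ, 4 ≤ P' μ) (c : ↥(cubes D.toDomains)) (a : (geomT D).Site) :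
    a ∈ ST D hMh1 hP4 c ↔ a ∈ QT D hMh1 hP4 c := Iff.rfl

/-- **`supp h_□ ⊂ ⋃ Q^T_□`** (blockwise): `h_□(b) ≠ 0 ⟹ y(b₋) ∈ Q^T_□`. [cite: Balaban1984PropagatorsII, (2.36) p.229 («h_□ ∈ C₀^∞(□̃)»)] -/
theorem blkV1_mem_QT_of_hB_ne_zero (hMh : 2 ≤ Mh) (hR : 2 * (ℓ + 1) ≤ R) {hMh1 : 1 ≤ Mh} (hP4 : ∀ μ, 4 ≤ P' μ) (c : ↥(cubes D.toDomains))
    {b : PBond (PV d ℓ m K hd hL) 0} (h : hB hN D c b ≠ 0) : blkV1 hN D b ∈ ST D hMh1 hP4 c :=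
  blkOf_mem_QT_of_hT_ne_zero hMh hR hP4 c h

/-- **`ζ_□h_□ = h_□`** as multiplication operators. [cite: Balaban1984PropagatorsII, (2.91) p.239 («ζ_□ = 1 on a neighbourhood of supp h_□»)] -/
theorem mulOp_zB_mul_hB (hMh : 2 ≤ Mh) (hR : 2 * (ℓ + 1) ≤ R) {hMh1 : 1 ≤ Mh} (hP4 : ∀ μ, 4 ≤ P' μ) (c : ↥(cubes D.toDomains)) :
    mulOp (zB hN D hMh1 hP4 c) * mulOp (hB hN D c) = mulOp (hB hN D c) := by
  apply LinearMap.ext; intro v; funext b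
  simp only [Module.End.mul_apply, mulOp_apply, hB_apply, zB_apply, ← mul_assoc, zetaT_mul_hT hMh hR hP4]

/-- **`h_□ζ_□ = h_□`**. [cite: Balaban1984PropagatorsII, (2.91) p.239] -/
theorem mulOp_hB_mul_zB (hMh : 2 ≤ Mh) (hR : 2 * (ℓ + 1) ≤ R) {hMh1 : 1 ≤ Mh} (hP4 : ∀ μ, 4 ≤ P' μ) (c : ↥(cubes D.toDomains)) :
    mulOp (hB hN D c) * mulOp (zB hN D hMh1 hP4 c) = mulOp (hB hN D c) := by
  apply LinearMap.ext; intro v; funext b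
  simp only [Module.End.mul_apply, mulOp_apply, hB_apply, zB_apply, ← mul_assoc, mul_comm (hT D c _) (zetaT D _ _ c _), zetaT_mul_hT hMh hR hP4]

/-- `Σ_□ h_□·h_□ = 1` as operators. [cite: Balaban1984PropagatorsII, (2.36) p.229] -/
theorem sum_mulOp_hB_sq (hMh1 : 1 ≤ Mh) (hP : ∀ μ, 1 ≤ P' μ) :
    ∑ c ∈ Finset.univ, mulOp (hB hN D c) * mulOp (hB hN D c) = (1 : Module.End ℝ (PBond (PV d ℓ m K hd hL) 0 → ℝ)) := by
  apply LinearMap.ext; intro v; funext b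
  simp only [LinearMap.coe_sum, Finset.sum_apply, Module.End.mul_apply, mulOp_apply, Module.End.one_apply, ← mul_assoc]
  rw [← Finset.sum_mul]
  have : ∑ c ∈ Finset.univ, hB hN D c b * hB hN D c b = 1 := by simpa only [sq] using sum_hB_sq hN D hMh1 hP b
  rw [this, one_mul]

end Data

/-! ## §2  THE SKELETON OF THE k-LEVEL PROPOSITION 2.6, ENTRY (2.136)₁, ON THE V1 GLOBAL TORUS: everything global discharged, per-cube member data displayed -/

section Skeleton

/-- `GΔ_a = 1` read on bond functions. [cite: Balaban1984PropagatorsII, (2.22) p.226] -/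
theorem onFun_GE_mul_deltaAE {P : Params} (Dm : B6SectADomainsV1.Domains P) {c : ℝ} (hc : c ≠ 0) {w : BondIdx Dm → ℝ} (hw : ∀ i, 0 < w i) :
    onFun (GE Dm hc hw) * onFun (deltaAE Dm c w) = 1 := by
  rw [Module.End.mul_eq_comp, ← onFun_comp, GE_comp_deltaAE, onFun_id, Module.End.one_eq_id]

/-- the printed prefactor `(L^{j(y)}η)²` of (2.136)₁ with `η := 1/c′` (the fine lattice spacing in the units of the V1 factor `c′`).
[cite: Balaban1984PropagatorsII, (2.136) p.247] -/
def pref (c' : ℝ) {D : TDomains d ℓ Mh k P' R} (y : (geomT D).Site) : ℝ := ((((ℓ + 1 : ℕ) : ℝ)) ^ y.1.1 / c') ^ 2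

/-- the prefactor is non-negative. [cite: Balaban1984PropagatorsII, (2.136) p.247, bookkeeping] -/
theorem pref_nonneg (c' : ℝ) {D : TDomains d ℓ Mh k P' R} (y : (geomT D).Site) : 0 ≤ pref c' y := sq_nonneg _

open Classical in
/-- **PROPOSITION 2.6, ENTRY (2.136)₁, FOR THE GENUINE k-LEVEL `G = Δ_a⁻¹` ON THE V1 TORUS — THE ASSEMBLY SKELETON** (B6-CLOSURE §5 item 13 (iv),
everything GLOBAL discharged, the per-cube MEMBER data displayed in their final shapes).  There are `δ₂ > 0`, `A ≥ 0` (on `d, L, a₀, a₁`; any such pair —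
the statement is uniform) … precisely: FOR ALL `δ > 0`, `A ≥ 0` and every V1 global torus carrying p21's torus family `D` (`hN`, `hk`, `L ≥ 2`,
`M_h ≥ 2`, `R ≥ 2L`, `P′_μ ≥ 5`), Lemma-2.1 budget `α ∈ [0,1]`, `N₀` with `N₀ + 1 ≤ R·M` and the (2.59)-shape threshold, fine factor `c′ ≠ 0` and
positive weights `w` of the GLOBAL `Δ_a := deltaAE (domT hN D hk) c′ w`, an overlap bound `Nov` of p38's reach sets `Q^T_□`, and PER CUBE `□` of p21's
cover `𝒟 = cubes D` abstract member operators `G_□, M_□, P_□` on the fine bonds such that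
(h2133) `G_□` has the (2.133)-local majorant `A·(L^{j(y)}/c′)²·e^{−(δ′/2)d_T}` on `Q^T_□` (`δ′ := 2δ/(d+1)`),
(hagree) `M·h_□ = M_□·h_□` for the LOCAL PART `M = ∂*∂ + ∂∂* + Q*aQ` of `Δ_a`,
(hinvl) `(M_□ − P_□)·G_□·h_□ = h_□`,
(h2134) the (2.91)-family `K_{□,□′}G_{□′}h_{□′}` built from `∂P∂* := ∂(1 − R)∂*` of `Δ_a`, p38's `h^T_□`, `ζ^T_□` and these members has the majorant
`θ₀e^{−(δ′/2)d_T}` for all pairs and is output-localised to `Q^T_□` (hKout), with the located smallness `Nov²θ₀c₁ < 1` —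
THEN THE GENUINE `G = (Δ_a)⁻¹ = GE (domT hN D hk)` has the majorant `(Nov·A)·c₁·(1 − Nov²θ₀c₁)⁻¹·(L^{j(y)}/c′)²·e^{−δ₃d_T(y,y′)}` on `geomT D` for the
global block map — (2.136)₁ `|G(x,x′)| ≤ C(L^jη)²e^{−δ₃d(y,y′)}` with print's prefactor.  DISCHARGED HERE (vs. `B6GlobalChartV1.prop26_2136_V1_of_2134_eq291`):
the partition data (`Σh_□² = 1`, `|h_□| ≤ 1`, supports in `Q^T_□`, `ζ_□h_□ = h_□ = h_□ζ_□` — p38's torus files), `Δ_a = M − ∂P∂*` (`deltaAE_split`),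
`GΔ_a = 1` (`GE_comp_deltaAE`), (2.91) (`eq291`), Lemma 2.1 on the torus (`lemma21_torus`) and the gluing (`prop26_2136_of_2133_2134With` with the
weight `P(y) = (L^{j(y)}/c′)²`).  [cite: Balaban1984PropagatorsII, Prop. 2.6 (2.136) p.247, (2.133)–(2.135) p.247, (2.91)–(2.93) p.239, (2.36) p.229, Lemma 2.1 p.234] -/
theorem prop26_2136_kLevel_skeleton (hN : ∀ μ, N0 ℓ Mh k P' μ = (PV d ℓ m K hd hL).sitesPerDir 0) (D : TDomains d ℓ Mh k P' R) (hk : k ≤ m + K)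
    (hMh : 2 ≤ Mh) (hR : 2 * (ℓ + 1) ≤ R) (hP5 : ∀ μ, 5 ≤ P' μ)
    -- rate and (2.133) constant
    {δ A : ℝ} (hδ : 0 < δ) (hA : 0 ≤ A)
    -- Lemma 2.1 budget on the torus
    (α : ℝ) (hα0 : 0 ≤ α) (hα1 : α ≤ 1) (N₀ : ℕ) (hN₀ : 0 < N₀) (hRM : N₀ + 1 ≤ R * ((ℓ + 1) * Mh))
    (hθ : Real.exp (-(α * (δ / (d + 1)))) * ((ℓ : ℝ) + 1) ^ ((2 * (d + 1 : ℕ) : ℝ) / N₀) < 1)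
    -- the global operator: fine factor and weights
    {cf : ℝ} (hcf : cf ≠ 0) {w : BondIdx (domT hN D hk) → ℝ} (hw : ∀ i, 0 < w i)
    -- overlap of the reach sets
    (Nov : ℕ) (hNov : ∀ a : (geomT D).Site, (Finset.univ.filter fun c : ↥(cubes D.toDomains) =>
      a ∈ (ST D (le_trans one_le_two hMh) (fun μ => le_trans (by norm_num) (hP5 μ)) c)).card ≤ Nov)
    -- per-cube members
    (Gl Ml Pl : ↥(cubes D.toDomains) → Module.End ℝ (PBond (PV d ℓ m K hd hL) 0 → ℝ))
    (h2133 : ∀ c, LocalMajorant (g := geomT D) (blkV1 hN D) (Gl c)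
      (ST D (le_trans one_le_two hMh) (fun μ => le_trans (by norm_num) (hP5 μ)) c)
      (fun a b => A * pref cf a * Real.exp (-((2 * (δ / (d + 1))) / 2 * (geomT D).dist a b))))
    (hagree : ∀ c, onFun (dcsE (P := PV d ℓ m K hd hL) cf ∘ₗ dcE cf + dE cf ∘ₗ dsE cf +
        QsE (domT hN D hk) ∘ₗ aE (domT hN D hk) w ∘ₗ QE (domT hN D hk)) * mulOp (hB hN D c) = Ml c * mulOp (hB hN D c))
    (hinvl : ∀ c, (Ml c - Pl c) * Gl c * mulOp (hB hN D c) = mulOp (hB hN D c))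
    -- (2.134) for the genuine (2.91) family, output localisation, smallness
    (θ₀ : ℝ) (hθ₀ : 0 ≤ θ₀)
    (h2134 : ∀ c c', HasMajorant (g := geomT D) (blkV1 hN D)
      ((kFam (onFun (dE (P := PV d ℓ m K hd hL) cf ∘ₗ (LinearMap.id - RE (domT hN D hk) cf) ∘ₗ dsE cf))
          (fun c => mulOp (hB hN D c)) (fun c => mulOp (zB hN D (le_trans one_le_two hMh) (fun μ => le_trans (by norm_num) (hP5 μ)) c))
          Ml Pl c c' * Gl c') * mulOp (hB hN D c'))
      (fun a b => θ₀ * Real.exp (-((2 * (δ / (d + 1))) / 2 * (geomT D).dist a b))))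
    (hKout : ∀ c c', OutLoc (g := geomT D) (blkV1 hN D)
      (kFam (onFun (dE (P := PV d ℓ m K hd hL) cf ∘ₗ (LinearMap.id - RE (domT hN D hk) cf) ∘ₗ dsE cf))
          (fun c => mulOp (hB hN D c)) (fun c => mulOp (zB hN D (le_trans one_le_two hMh) (fun μ => le_trans (by norm_num) (hP5 μ)) c))
          Ml Pl c c' * Gl c')
      (ST D (le_trans one_le_two hMh) (fun μ => le_trans (by norm_num) (hP5 μ)) c))
    (hsmall : (Nov : ℝ) ^ 2 * θ₀ * K261 N₀ (d + 1) ((ℓ : ℝ) + 1) 1 (α * (δ / (d + 1))) < 1) :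
    HasMajorant (g := geomT D) (blkV1 hN D) (onFun (GE (domT hN D hk) hcf hw))
      (fun a b => (Nov * A) * K261 N₀ (d + 1) ((ℓ : ℝ) + 1) 1 (α * (δ / (d + 1))) *
        (1 - (Nov : ℝ) ^ 2 * θ₀ * K261 N₀ (d + 1) ((ℓ : ℝ) + 1) 1 (α * (δ / (d + 1))))⁻¹ * pref cf a *
        Real.exp (-(delta3 α (2 * (δ / (d + 1))) * (geomT D).dist a b))) := by
  classical
  have hMh1 : 1 ≤ Mh := le_trans one_le_two hMh
  have hP4 : ∀ μ, 4 ≤ P' μ := fun μ => le_trans (by norm_num) (hP5 μ)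
  have hP : ∀ μ, 1 ≤ P' μ := one_le_of_four_le hP4
  -- Lemma 2.1 on the torus at rate δ₀ := δ/(d+1) with the split α
  have hδ0 : (0 : ℝ) ≤ δ / (d + 1) := by positivity
  obtain ⟨_, h261, _, h263⟩ := lemma21_torus D hMh1 hP hN₀ hRM hδ0 hα0 hα1 hθ
  obtain ⟨htri, hrefl, hdnn⟩ := triangle_refl_nonneg_T D hMh1 hP
  have hc : 0 ≤ K261 N₀ (d + 1) ((ℓ : ℝ) + 1) 1 (α * (δ / (d + 1))) := K261_nonneg (by positivity) zero_le_one
  have hδ2 : (0 : ℝ) ≤ 2 * (δ / (d + 1)) := by positivity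
  have hhalf : 2 * (δ / (d + 1)) / 2 = δ / (d + 1) := by ring
  -- the partition data
  have hle : ∀ c ∈ (Finset.univ : Finset ↥(cubes D.toDomains)), ∀ b, |hB hN D c b| ≤ 1 := fun c _ b => abs_hB_le_one hN D hMh1 hP c b
  have hsupp : ∀ c ∈ (Finset.univ : Finset ↥(cubes D.toDomains)), ∀ b, hB hN D c b ≠ 0 →
      blkV1 hN D b ∈ ST D hMh1 hP4 c := fun c _ b hb => blkV1_mem_QT_of_hB_ne_zero hN D hMh hR hP4 c hb
  -- (2.91) from the ring identity with the displayed member data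
  have h291 : onFun (deltaAE (domT hN D hk) cf w) * gZero Finset.univ (fun c => mulOp (hB hN D c)) Gl =
      1 - rOp Finset.univ (onFun (dE (P := PV d ℓ m K hd hL) cf ∘ₗ (LinearMap.id - RE (domT hN D hk) cf) ∘ₗ dsE cf))
        (fun c => mulOp (hB hN D c)) (fun c => mulOp (zB hN D hMh1 hP4 c)) Gl Ml Pl := by
    rw [deltaAE_split]
    exact eq291 Finset.univ _ _ (fun c => mulOp (hB hN D c)) (fun c => mulOp (zB hN D hMh1 hP4 c)) Gl Ml Pl
      (sum_mulOp_hB_sq hN D hMh1 hP) (fun c _ => hagree c) (fun c _ => hinvl c)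
      (fun c _ => mulOp_zB_mul_hB hN D hMh hR hP4 c) (fun c _ => mulOp_hB_mul_zB hN D hMh hR hP4 c)
  have hinv := onFun_GE_mul_deltaAE (domT hN D hk) hcf hw
  have hmain := prop26_2136_of_2133_2134With (g := geomT D) (blkV1 hN D) (K261 N₀ (d + 1) ((ℓ : ℝ) + 1) 1 (α * (δ / (d + 1))))
    (2 * (δ / (d + 1))) α θ₀ A (pref cf) hc hA (pref_nonneg cf) hθ₀ hα1 hδ2 htri hrefl hdnn (by rw [hhalf]; exact h261) (by rw [hhalf]; exact h263)
    Finset.univ (fun c => ST D hMh1 hP4 c) Nov hNov hsmall (hB hN D) hsupp hle Gl (fun c _ => h2133 c)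
    (fun c c' => kFam (onFun (dE (P := PV d ℓ m K hd hL) cf ∘ₗ (LinearMap.id - RE (domT hN D hk) cf) ∘ₗ dsE cf))
      (fun c => mulOp (hB hN D c)) (fun c => mulOp (zB hN D hMh1 hP4 c)) Ml Pl c c' * Gl c')
    (fun c _ c' _ => h2134 c c') (fun c _ c' _ => hKout c c') (G0 := gZero Finset.univ (fun c => mulOp (hB hN D c)) Gl)
    (R := rOp Finset.univ (onFun (dE (P := PV d ℓ m K hd hL) cf ∘ₗ (LinearMap.id - RE (domT hN D hk) cf) ∘ₗ dsE cf))
      (fun c => mulOp (hB hN D c)) (fun c => mulOp (zB hN D hMh1 hP4 c)) Gl Ml Pl) rfl rfl hinv h291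
  exact hmain

end Skeleton

end Literature.MathematicalPhysics.QuantumFieldTheory.Balaban1983to89.B6Prop26KLevelSkeletonV1

end
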